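import Mathlib
import Literature.Topology.FourManifolds.LefschetzHandlebody
import Literature.Topology.FourManifolds.SmoothOrientation
import Literature.AlgebraicTopology.SingularHomology.SingularChains
import HarnessLib

/-!
# Stub `stub_modelsOnFibred_balance` (NF3), line `modp-braid-orbits` of crux
# `ConvexBisection.AcyclicBisectionExists` — structural ingredients

The registered stub `stub_modelsOnFibred_balance` is, verbatim unfolded, the named Literature fact
`Literature.Topology.FourManifolds.LefschetzBase.modelsOnFibred_balance_of_homotopyEquiv_sphere`
(Etnyre–Fuller 2006, eq. (d3): a FIBRED Lefschetz model `ModelsOnFibred M g l` of a homotopy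
4-sphere has exactly `2g` positive letters).  Its printed proof starts from the fact that the
gluing diffeomorphism `Ψ : ∂X ≅ ∂ Base g` of a fibred model is an isomorphism of open books: the
page condition of `ModelsOnFibred` (same page angle `arg w`, binding to binding) is imposed at the
seam points `bX.incl y = D.jA a` coming from the base piece `Base g ∖ ⋃ cores` of the
multi-attachment `X = Base g ∪ (2-handles)`.  This file PROVES the plumbing behind "starts from":

* `jB_mem_range_jA_of_lamSq_ne_zero`, `exists_jA_eq_or_belt` — in Kosinski's corner-free
  attachment (`HandleAttachingMap.MultiAttachmentData`) the base piece `jA (M ∖ ⋃ h̄ᵢ(S))` covers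
  the attached manifold `P` except for the BELT DISCS `jBᵢ {x_λ = 0}` (a handle point `x` with
  `x_λ ≠ 0` lies in `T ∖ S` and is glued to `h̄ᵢ (α x)`; Kosinski 1993, VI §6);
* `seam_page_or_belt` — hence on the seam `∂X` of a Lefschetz handlebody every point either comes
  from a BOUNDARY point of the base off the attaching circles (where the page condition of a
  fibred model applies) or lies on one of the finitely many BELT CIRCLES
  `jBᵢ {x_λ = 0, ‖x‖ = 1}`;
* `ModelsOnFibred.page_or_belt` — the page condition of a fibred model therefore binds on the
  whole seam minus the belt circles, and there it carries binding to binding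
  (`w_eq_zero_iff_of_exists_pos_mul`): the fibred gluing preserves the page angle on a dense open
  subset of `∂X`, which is what makes the geometric (not only homological) monodromy of the word
  trivial in the printed argument.

(Genus `0` — contractibility of `Base 0` and of its piece off the attaching circles, the input of
the `g = 0` instance — is the companion file `…StubModelsOnFibredBalanceGenusZero.lean`.)

Nothing is asserted; the registered signature itself (an XL formalisation of Etnyre–Fuller's `d₃`
computation for the closed-up achiral Lefschetz fibration) is NOT proved here.

References: A. A. Kosinski, *Differential Manifolds* (1993), VI §6 [Kosinski1993];
J. B. Etnyre, T. Fuller, IMRN 2006, proof of Thm. 1 (p. 8) and eq. (d3) [EtnyreFuller2006].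
-/

noncomputable section

set_option linter.dupNamespace false

open scoped Manifold ContDiff Topology
open Set Function Metric

namespace Summit.SmoothPoincare4.SmoothPoincare4.Theorems.AcyclicBisectionExists.ModpBraidOrbits

open Literature.Topology.FourManifolds Literature.Topology.FourManifolds.LefschetzBase
open Literature.Topology.FourManifolds.HandleAttachingMap

section Seam

variable {n k : ℕ} {M : Type*} [TopologicalSpace M] [T2Space M]
  [ChartedSpace (EuclideanHalfSpace (n + 1)) M]
  {ι : Type*} [Finite ι] {h : ι → HandleAttachingMap n k M}
  {EP HP : Type*} [NormedAddCommGroup EP] [NormedSpace ℝ EP] [TopologicalSpace HP]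
  {IP : ModelWithCorners ℝ EP HP} {P : Type*} [TopologicalSpace P] [ChartedSpace HP P]

/-- **Off the belt disc a handle point already lies in the base piece**: in a simultaneous
attachment of handles along the `h̄ᵢ`, a point `jBᵢ x` of the `i`-th handle with `x_λ ≠ 0`
(so `x ∈ T ∖ S`) is the point `jA (h̄ᵢ (α x))` of the piece `M ∖ ⋃ h̄ᵢ(S)` — Kosinski's
identification `x ∼ h̄ α(x)` read backwards through the involution `α`.
[cite: Kosinski1993, VI §6] -/
theorem jB_mem_range_jA_of_lamSq_ne_zero (D : MultiAttachmentData h IP P) (i : ι)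
    {b : ↥(beltPiece n k)} (hb0 : lamSq k b.1.1 ≠ 0) :
    D.jB i b ∈ range D.jA := by
  -- adapted from `HandleAttachingMap.LocalityData.jB_mem_range_jA`
  -- (Literature/Topology/FourManifolds/HandleAttachingMapsLocality.lean)
  set y : ↥(handleTube n k) := handleInversionPt b.1 hb0 b.2 with hy_def
  have hb0' : 0 < lamSq k b.1.1 :=
    lt_of_le_of_ne (lamSq_nonneg k _) (Ne.symm hb0)
  have hb1' : lamSq k b.1.1 < 1 :=
    lt_of_le_of_ne (lamSq_le_one (mem_closedBall_zero_iff.1 b.1.2)) b.2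
  have hy1 : lamSq k (y.1.1) ≠ 1 := (handleInversion_mem hb0 b.2).2.2
  have hrel := (h i).glueRel_apply y hy1
  have hαy : (handleInversionPt y.1 y.2 hy1 : ↥(handleTube n k)).1 = b.1 := by
    apply Subtype.ext
    rw [coe_coe_handleInversionPt, hy_def, coe_coe_handleInversionPt,
      handleInversion_handleInversion hb0' hb1']
  rw [hαy] at hrel
  have hmem : (h i).toFun y ∈ coresComplement h := by
    rw [mem_coresComplement]
    intro j hj
    by_cases hji : j = i
    · subst hji
      exact hrel.not_mem_core hj
    · exact Set.disjoint_left.1 (D.disjoint (Ne.symm hji)) (mem_range_self y)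
        (image_subset_range _ _ hj)
  exact ⟨⟨(h i).toFun y, hmem⟩, (D.glue i _ _).2 hrel⟩

/-- **The base piece covers the attached manifold except for the belt discs**: every point of
`P = M ∪ (handles)` is either a point `jA a` of the piece `M ∖ ⋃ h̄ᵢ(S)` or a point `jBᵢ x` of a
handle ON ITS BELT DISC `x_λ = 0` (Kosinski 1993, VI §6: "`Dᵐ ∩ ℝ^μ` the belt disc"; the
complement `Dᵐ ∖ (S ∪ {x_λ = 0}) = T ∖ S` is glued to `M`). [cite: Kosinski1993, VI §6] -/
theorem exists_jA_eq_or_belt (D : MultiAttachmentData h IP P) (p : P) :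
    (∃ a, D.jA a = p) ∨
      ∃ (i : ι) (b : ↥(beltPiece n k)), lamSq k b.1.1 = 0 ∧
        D.jB i b = p := by
  rcases D.mem_range_or p with h1 | ⟨i, b, rfl⟩
  · exact Or.inl h1
  · by_cases hb0 : lamSq k b.1.1 = 0
    · exact Or.inr ⟨i, b, hb0, rfl⟩
    · exact Or.inl (jB_mem_range_jA_of_lamSq_ne_zero D i hb0)

end Seam

section SeamBoundary

variable {g : ℕ} {ι : Type*} [Finite ι] {h : ι → HandleAttachingMap 3 2 (Base g)}
  {X : Type*} [TopologicalSpace X] [ChartedSpace (EuclideanHalfSpace 4) X]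

/-- **The seam of a Lefschetz handlebody, off the belt circles, comes from the boundary of the
base.**  For `X` the base `Base g` with 2-handles attached along the `h̄ᵢ` (data `D`) and any
boundary datum `bX` of `X`, every seam point `bX.incl y` is either `jA a` for a BOUNDARY point
`a` of the base off the attaching circles (open smooth embeddings and open submanifolds preserve
boundary points), or a point `jBᵢ x` of a handle on its BELT CIRCLE `x_λ = 0`, `‖x‖ = 1`
(`∂𝔻⁴ = {‖x‖ = 1}`). [cite: Kosinski1993, VI §6] -/
theorem seam_page_or_belt (D : MultiAttachmentData h (𝓡∂ 4) X) (bX : BoundaryData (𝓡∂ 4) X (𝓡 3))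
    (y : bX.carrier) :
    (∃ a : ↥(coresComplement h), bX.incl y = D.jA a ∧
        (a : Base g) ∈ (𝓡∂ 4).boundary (Base g)) ∨
      ∃ (i : ι) (b : ↥(beltPiece 3 2)), lamSq 2 b.1.1 = 0 ∧
        ‖b.1.1‖ = 1 ∧ bX.incl y = D.jB i b := by
  have hy : bX.incl y ∈ (𝓡∂ 4).boundary X := bX.incl_mem_boundary y
  rcases exists_jA_eq_or_belt D (bX.incl y) with ⟨a, ha⟩ | ⟨i, b, hb0, hb⟩
  · refine Or.inl ⟨a, ha.symm, ?_⟩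
    rw [← ha] at hy
    have h1 : a ∈ (𝓡∂ 4).boundary ↥(coresComplement h) :=
      (mem_boundary_iff_of_isSmoothEmbedding D.hjA D.hjAo a).1 hy
    exact (mem_boundary_opens_iff (coresComplement h) a).1 h1
  · refine Or.inr ⟨i, b, hb0, ?_, hb.symm⟩
    rw [← hb] at hy
    have h1 : b ∈ (𝓡∂ 4).boundary ↥(beltPiece 3 2) :=
      (mem_boundary_iff_of_isSmoothEmbedding (D.hjB i).1 (D.hjB i).2 b).1 hy
    have h2 : b.1 ∈ (𝓡∂ 4).boundary ↥(closedBall (0 : EuclideanSpace ℝ (Fin 4)) 1) :=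
      (mem_boundary_opens_iff (beltPiece 3 2) b).1 h1
    rw [boundary_closedBall] at h2
    exact h2

end SeamBoundary

/-- A complex number which is a positive real multiple of another vanishes iff the other does
(the page condition of a fibred model carries binding `w = 0` to binding). [folklore] -/
theorem w_eq_zero_iff_of_exists_pos_mul {u v : ℂ} (huv : ∃ c : ℝ, 0 < c ∧ u = (c : ℂ) * v) :
    u = 0 ↔ v = 0 := by
  obtain ⟨c, hc, rfl⟩ := huv
  have hc' : (c : ℂ) ≠ 0 := Complex.ofReal_ne_zero.2 hc.ne'
  simp [hc']

/-- **The page condition of a fibred model binds on the whole seam off the belt circles.**  If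
`ModelsOnFibred M g l`, then `M = X ∪_Ψ Base g` for a Lefschetz handlebody `X` of word `l` (data
`h`, `D`, `bX`, `Ψ` as in the definition) such that EVERY seam point `y ∈ ∂X` either lies on one
of the `l.length` belt circles `jBᵢ {x_λ = 0, ‖x‖ = 1}` of the handles, or comes from a boundary
point `a` of the base off the attaching circles, and then `Ψ y` has the page angle of `a`
(`w (Ψ y) ∈ ℝ_{>0} · w a`), in particular `Ψ y` is on the binding `w = 0` iff `a` is.  (The
honest fibred model of Etnyre–Fuller 2006, proof of Thm. 1, p. 8, read through Kosinski's
corner-free handles: the base piece of `X` is the complement of the belt discs.)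
[cite: EtnyreFuller2006, Thm. 1 (proof, p. 8)] -/
theorem ModelsOnFibred.page_or_belt {M : Type} [TopologicalSpace M]
    [ChartedSpace (EuclideanSpace ℝ (Fin 4)) M]
    {g : ℕ} {l : List ((Fin g ⊕ Fin g → ℤ) × Bool)} (hM : ModelsOnFibred M g l) :
    ∃ (X : Type) (_ : TopologicalSpace X) (_ : T2Space X) (_ : SecondCountableTopology X)
      (_ : CompactSpace X) (_ : ChartedSpace (EuclideanHalfSpace 4) X) (_ : IsManifold (𝓡∂ 4) ∞ X)
      (h : Fin l.length → HandleAttachingMap 3 2 (Base g))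
      (D : HandleAttachingMap.MultiAttachmentData h (𝓡∂ 4) X)
      (bX : BoundaryData (𝓡∂ 4) X (𝓡 3)) (Ψ : bX.carrier ≃ₘ⟮𝓡 3, 𝓡 3⟯ (bBase g).carrier),
      IsLefschetzLink g l h ∧ IsBoundaryGluing bX (bBase g) Ψ (𝓡 4) M ∧
      ∀ y : bX.carrier,
        (∃ a : ↥(HandleAttachingMap.coresComplement h), bX.incl y = D.jA a ∧
            (a : Base g) ∈ (𝓡∂ 4).boundary (Base g) ∧
            (∃ c : ℝ, 0 < c ∧ w g ((bBase g).incl (Ψ y)).1 = (c : ℂ) * w g (a : Base g).1) ∧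
            (w g ((bBase g).incl (Ψ y)).1 = 0 ↔ w g (a : Base g).1 = 0)) ∨
          ∃ (i : Fin l.length) (b : ↥(beltPiece 3 2)), lamSq 2 b.1.1 = 0 ∧
            ‖b.1.1‖ = 1 ∧ bX.incl y = D.jB i b := by
  obtain ⟨X, _, _, _, _, _, _, h, D, bX, Ψ, hlink, hglue, hpage⟩ := hM
  refine ⟨X, inferInstance, inferInstance, inferInstance, inferInstance, inferInstance,
    inferInstance, h, D, bX, Ψ, hlink, hglue, fun y => ?_⟩
  rcases seam_page_or_belt D bX y with ⟨a, hya, ha⟩ | hbelt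
  · exact Or.inl ⟨a, hya, ha, hpage y a hya, w_eq_zero_iff_of_exists_pos_mul (hpage y a hya)⟩
  · exact Or.inr hbelt

/-- **Registered sub-goal `stub_modelsOnFibred_pageOrBelt` of `stub_modelsOnFibred_balance`**
(the statement of `ModelsOnFibred.page_or_belt` with explicit binders and no local notation): the
page condition of a fibred model binds on the whole seam off the `l.length` belt circles, carrying
binding to binding there. [cite: EtnyreFuller2006, Thm. 1 (proof, p. 8)] -/
theorem stub_modelsOnFibred_pageOrBelt :
    ∀ (M : Type) [TopologicalSpace M] [ChartedSpace (EuclideanSpace ℝ (Fin 4)) M] (g : ℕ)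
      (l : List ((Fin g ⊕ Fin g → ℤ) × Bool)), ModelsOnFibred M g l →
      ∃ (X : Type) (_ : TopologicalSpace X) (_ : T2Space X) (_ : SecondCountableTopology X)
        (_ : CompactSpace X) (_ : ChartedSpace (EuclideanHalfSpace 4) X) (_ : IsManifold (𝓡∂ 4) ∞ X)
        (h : Fin l.length → HandleAttachingMap 3 2 (Base g))
        (D : HandleAttachingMap.MultiAttachmentData h (𝓡∂ 4) X)
        (bX : BoundaryData (𝓡∂ 4) X (𝓡 3)) (Ψ : bX.carrier ≃ₘ⟮𝓡 3, 𝓡 3⟯ (bBase g).carrier),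
        IsLefschetzLink g l h ∧ IsBoundaryGluing bX (bBase g) Ψ (𝓡 4) M ∧
        ∀ y : bX.carrier,
          (∃ a : ↥(HandleAttachingMap.coresComplement h), bX.incl y = D.jA a ∧
              (a : Base g) ∈ (𝓡∂ 4).boundary (Base g) ∧
              (∃ c : ℝ, 0 < c ∧ w g ((bBase g).incl (Ψ y)).1 = (c : ℂ) * w g (a : Base g).1) ∧
              (w g ((bBase g).incl (Ψ y)).1 = 0 ↔ w g (a : Base g).1 = 0)) ∨
            ∃ (i : Fin l.length) (b : ↥(beltPiece 3 2)),
              lamSq 2 (((b : Metric.closedBall (0 : EuclideanSpace ℝ (Fin 4)) 1) :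
                EuclideanSpace ℝ (Fin 4))) = 0 ∧
              ‖((b : Metric.closedBall (0 : EuclideanSpace ℝ (Fin 4)) 1) :
                EuclideanSpace ℝ (Fin 4))‖ = 1 ∧ bX.incl y = D.jB i b :=
  fun _ _ _ _ _ hM => ModelsOnFibred.page_or_belt hM

end Summit.SmoothPoincare4.SmoothPoincare4.Theorems.AcyclicBisectionExists.ModpBraidOrbits
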